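import Summits.ResolutionOfSingularities.ResolutionOfSingularities.Theorems.HomologicalConductorNoZenoZariskiDescent
import Summits.ResolutionOfSingularities.ResolutionOfSingularities.Theorems.HomologicalConductorNoZenoZariskiAbsorption
import Summits.ResolutionOfSingularities.ResolutionOfSingularities.Theorems.HomologicalConductorNoZenoThreadDichotomy
import HarnessLib

/-!
# Route `HomologicalConductor`, crux `NoZenoR` (stmt-ResolutionOfSingularities-19943; aside twin `NoZeno` 16483):
# ZARISKI DESCENT ALONG A DIVISORIAL THREAD — the free hypotheses of (NDT-BP) / (NDT-abs) / (NDT-PC) are theorems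

`[OURS · L W4.4]` Cell res-hironaka, crux chain W4.4, CHAIN v21 §3.10; res-L0-w44-stub-3.  The thread instantiation of the
Zariski-descent toolkit (`…NoZenoZariskiDescent`, `…NoZenoZariskiAbsorption`): along an infinite singular prime thread in
transcendence degree `3` past its escape stage `mₑ`, let a DISCRETE valuation ring `V ⊇ k` of `K` with two residually
independent elements (a prime divisor, CASE B of `Sandwiched.threadDichotomy`) dominate every germ
`D n := (T_(n+1))_(P_(n+1))` (`Parasite.locPrime`; the skeleton's `Beta2Descent.germ O A P hP n`).  Then:

* `germChain_mono`, `germChain_le`, `germChain_inv_mem`, `germChain_inv_mem_of_valuation_eq_one`, `germChain_frac`,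
  `mvPolynomial_aeval_mem_locPrime` — the chain hypotheses of the toolkit hold for the germ chain (domination-free plumbing);
* `exists_mem_not_mem_germChain` — **THE WITNESS**: some `t ∈ V`, a quotient `a / b` of elements of `A ⊆ D 0`, lies in NO
  germ (by (GRD) `Sandwiched.germResidueDep`: the two residually independent elements cannot both lie in a germ past the
  escape stage, and the germs increase);
* consequences, each the EXTRA HYPOTHESIS of one typed residual of the entry cut, now discharged:
  `germChain_eventually_not_principalizes` — Zariski's budget: cofinitely NO step principalizes at `V` ((NDT-BP)'s hypothesis,
  strat-1); `germChain_not_absorbing`, `germChain_eventually_no_vIdealStep` — the chain is not valuatively absorbing and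
  `V`-ideal steps do not recur ((NDT-abs), idea-1); `germChain_exists_undivided_pair` — the witness has an eventually
  UNDIVIDED representation ((NDT-PC)'s hypothesis, idea-2).

So the three residual formulations differ from (NDT) `Sig.NoDivisorialThread` only by hypotheses that are THEOREMS here; an
attacker may assume all of them at once.  Nothing here is a statement of the manuscript under review (Hironaka 2017);
AI-written, weaker than expert review.
-/

noncomputable section

-- single-problem summit: the doubled namespace component `ResolutionOfSingularities` is forced
set_option linter.dupNamespace false

open IsLocalRing
open Literature.AlgebraicGeometry.Resolution

namespace Summit.ResolutionOfSingularities.ResolutionOfSingularities.Theorems.NoZeno.ZariskiDescent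

open Summit.ResolutionOfSingularities.ResolutionOfSingularities.Theses.HomologicalConductor
open Summit.ResolutionOfSingularities.ResolutionOfSingularities.Theorems.NoZeno.Birth
open Summit.ResolutionOfSingularities.ResolutionOfSingularities.Theorems.NoZeno.SandwichCluster.Parasite
  (locPrime mem_locPrime_of_mem)
open Summit.ResolutionOfSingularities.ResolutionOfSingularities.Theorems.NoZeno.SandwichCluster
open Summit.ResolutionOfSingularities.ResolutionOfSingularities.Theorems.NoZeno.Sandwiched
  (locPrime_tower_subset_succ locPrime_tower_subset_of_le germResidueDep)

variable {k K : Type} [Field k] [Field K] [Algebra k K]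

/-! ## Plumbing: the germ chain satisfies the chain hypotheses of the toolkit -/

section Plumbing

variable (O : ValuationSubring K) (A : Subalgebra k K) (P : ∀ m : ℕ, Ideal ↥(tower O A m)) (hP : ∀ m, (P m).IsPrime)
  (hcompat : ∀ (m : ℕ) (x : K) (hx : x ∈ tower O A m) (hx' : x ∈ tower O A (m + 1)),
    (⟨x, hx'⟩ : ↥(tower O A (m + 1))) ∈ P (m + 1) ↔ (⟨x, hx⟩ : ↥(tower O A m)) ∈ P m)

/-- Polynomial expressions over `k` in elements of a germ `(T_m)_(P_m)` lie in the germ (it is a subring containing `k`).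
[this work] -/
theorem mvPolynomial_aeval_mem_locPrime (m : ℕ) {ι : Type} (z : ι → K)
    (hz : ∀ i, z i ∈ locPrime (tower O A m) (P m) (hP m)) (f : MvPolynomial ι k) :
    MvPolynomial.aeval z f ∈ locPrime (tower O A m) (P m) (hP m) := by
  induction f using MvPolynomial.induction_on with
  | C c =>
    rw [MvPolynomial.aeval_C]
    exact mem_locPrime_of_mem _ _ _ ((tower O A m).algebraMap_mem c)
  | add p q hp hq =>
    rw [map_add]
    exact add_mem hp hq
  | mul_X p i hp =>
    rw [map_mul, MvPolynomial.aeval_X]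
    exact mul_mem hp (hz i)

include hcompat in
/-- The germ chain `n ↦ D n = (T_(n+1))_(P_(n+1))` increases. [this work] -/
theorem germChain_mono (n : ℕ) :
    locPrime (tower O A (n + 1)) (P (n + 1)) (hP (n + 1)) ≤ locPrime (tower O A (n + 1 + 1)) (P (n + 1 + 1)) (hP (n + 1 + 1)) :=
  fun _ hx => locPrime_tower_subset_succ O A P hP hcompat (n + 1) hx

include hcompat in
/-- The germ chain is monotone in the index (two-argument form used by the absorption toolkit). [this work] -/
theorem germChain_mono' (m m' : ℕ) (h : m ≤ m') :
    locPrime (tower O A (m + 1)) (P (m + 1)) (hP (m + 1)) ≤ locPrime (tower O A (m' + 1)) (P (m' + 1)) (hP (m' + 1)) :=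
  fun _ hx => locPrime_tower_subset_of_le O A P hP hcompat (Nat.succ_le_succ h) hx

variable (V : ValuationSubring K)
  (hdomV : ∀ n : ℕ, SubringDominates (locPrime (tower O A (n + 1)) (P (n + 1)) (hP (n + 1))) V.toSubring)

include hdomV in
/-- Every germ lies in the dominating valuation ring. [this work] -/
theorem germChain_le (n : ℕ) : locPrime (tower O A (n + 1)) (P (n + 1)) (hP (n + 1)) ≤ V.toSubring := (hdomV n).1

include hdomV in
/-- Domination, inverse form: an element of a germ whose inverse lies in `V` is a unit of the germ. [this work] -/
theorem germChain_inv_mem (n : ℕ) (x : K) (hx : x ∈ locPrime (tower O A (n + 1)) (P (n + 1)) (hP (n + 1)))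
    (hxV : x⁻¹ ∈ V) : x⁻¹ ∈ locPrime (tower O A (n + 1)) (P (n + 1)) (hP (n + 1)) :=
  (hdomV n).2 x hx hxV

include hdomV in
/-- Domination, valuation form: an element of a germ of `V`-value `1` is a unit of the germ. [this work] -/
theorem germChain_inv_mem_of_valuation_eq_one (n : ℕ) (x : K)
    (hx : x ∈ locPrime (tower O A (n + 1)) (P (n + 1)) (hP (n + 1))) (hvx : V.valuation x = 1) :
    x⁻¹ ∈ locPrime (tower O A (n + 1)) (P (n + 1)) (hP (n + 1)) :=
  (hdomV n).2 x hx ((V.valuation_le_one_iff _).mp (by rw [map_inv₀, hvx, inv_one]))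

/-- Every element of `K` — in particular of `V` — is a quotient of two elements of the first germ `D 0 = (T_1)_(P_1)`
(indeed of `A ⊆ T_1`, `Frac A = K`). [this work] -/
theorem germChain_frac (hfr : IsFractionRing ↥A K) (u : K) :
    ∃ a ∈ locPrime (tower O A (0 + 1)) (P (0 + 1)) (hP (0 + 1)),
      ∃ b ∈ locPrime (tower O A (0 + 1)) (P (0 + 1)) (hP (0 + 1)), b ≠ 0 ∧ u = a * b⁻¹ := by
  haveI := hfr
  obtain ⟨a, b, hb, hab⟩ := IsFractionRing.div_surjective (A := ↥A) u
  have hb0 : ((b : ↥A) : K) ≠ 0 := fun h => nonZeroDivisors.ne_zero hb (Subtype.ext h)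
  have hAg : ∀ x : K, x ∈ A → x ∈ locPrime (tower O A (0 + 1)) (P (0 + 1)) (hP (0 + 1)) := fun x hx =>
    mem_locPrime_of_mem _ _ _ (mem_tower_of_mem O A 1 x hx)
  exact ⟨a, hAg _ a.2, b, hAg _ b.2, hb0, by rw [← hab, div_eq_mul_inv]; rfl⟩

end Plumbing

/-! ## The witness and the discharged hypotheses -/

section Thread

variable (O : ValuationSubring K) (A : Subalgebra k K)
  (hk : ∀ c : k, algebraMap k K c ∈ O) (hA : A.FG) (hfr : IsFractionRing ↥A K)
  (hAO : A.toSubring ≤ O.toSubring) (htr : Algebra.trdeg k K = 3)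
  (P : ∀ m : ℕ, Ideal ↥(tower O A m)) (hP : ∀ m, (P m).IsPrime)
  (hcompat : ∀ (m : ℕ) (x : K) (hx : x ∈ tower O A m) (hx' : x ∈ tower O A (m + 1)),
    (⟨x, hx'⟩ : ↥(tower O A (m + 1))) ∈ P (m + 1) ↔ (⟨x, hx⟩ : ↥(tower O A m)) ∈ P m)
  (hca : ∀ (m : ℕ) (x : K) (hx : x ∈ tower O A m),
    x ∈ ca (tower O A m) → (⟨x, hx⟩ : ↥(tower O A m)) ∈ P m)
  (mₑ : ℕ) (s : K) (hsT : s ∈ tower O A mₑ) (hvs : O.valuation s < 1)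
  (hsP : (⟨s, hsT⟩ : ↥(tower O A mₑ)) ∉ P mₑ)
  (V : ValuationSubring K)
  (hy : ∃ y : Fin 2 → K, (∀ i, y i ∈ V) ∧
    ∀ f : MvPolynomial (Fin 2) k, f ≠ 0 → V.valuation (MvPolynomial.aeval y f) = 1)
  (hdomV : ∀ n : ℕ, SubringDominates (locPrime (tower O A (n + 1)) (P (n + 1)) (hP (n + 1))) V.toSubring)

include hk hA hfr hAO htr hcompat hca hsT hvs hsP hy hdomV in
/-- **THE WITNESS.**  Along a thread past its escape stage dominated by a valuation ring `V` carrying two residually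
independent elements `y 0, y 1` (`v(f(y)) = 1` for all `f ≠ 0`), some `t ∈ V` lies in NO germ `D n`, and `t = a / b` with
`a, b ∈ D 0`, `b ≠ 0`.  Proof: by (GRD) `Sandwiched.germResidueDep` no germ past `mₑ` contains both `y 0` and `y 1` (a
non-zero `f` with `f(y)` a non-unit of the germ would have `v(f(y)) = 1`, so `f(y)⁻¹ ∈ V`, so by domination `f(y)⁻¹` in the
germ); the germs increase, so one `y i` misses them all; fractions from `Frac A = K`, `A ⊆ T_1 ⊆ D 0`. [this work] -/
theorem exists_mem_not_mem_germChain :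
    ∃ t : K, t ∈ V ∧ (∀ n : ℕ, t ∉ locPrime (tower O A (n + 1)) (P (n + 1)) (hP (n + 1))) ∧
      ∃ a ∈ locPrime (tower O A (0 + 1)) (P (0 + 1)) (hP (0 + 1)),
        ∃ b ∈ locPrime (tower O A (0 + 1)) (P (0 + 1)) (hP (0 + 1)), b ≠ 0 ∧ t = a / b := by
  obtain ⟨y, hyV, hy1⟩ := hy
  -- (1) no germ past the escape stage contains both `y 0` and `y 1`
  have hnot : ∀ n : ℕ, mₑ ≤ n → ¬ (∀ i, y i ∈ locPrime (tower O A (n + 1)) (P (n + 1)) (hP (n + 1))) := by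
    intro n hn hz
    obtain ⟨f, hf0, hf⟩ := germResidueDep O A hk hA hfr hAO htr P hP hcompat hca mₑ s hsT hvs hsP n hn y hz
    have hv1 : V.valuation (MvPolynomial.aeval y f) = 1 := hy1 f hf0
    rcases hf with h | h
    · rw [h, map_zero] at hv1
      exact zero_ne_one hv1
    · exact h (germChain_inv_mem_of_valuation_eq_one O A P hP V hdomV n _
        (mvPolynomial_aeval_mem_locPrime O A P hP (n + 1) y hz f) hv1)
  -- (2) hence one of the `y i` lies in no germ
  have ht : ∃ t : K, t ∈ V ∧ ∀ n, t ∉ locPrime (tower O A (n + 1)) (P (n + 1)) (hP (n + 1)) := by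
    by_contra hcon
    have hex : ∀ i, ∃ n, y i ∈ locPrime (tower O A (n + 1)) (P (n + 1)) (hP (n + 1)) := fun i => by
      by_contra h
      exact hcon ⟨y i, hyV i, fun n hn => h ⟨n, hn⟩⟩
    choose N hN using hex
    refine hnot (max mₑ (max (N 0) (N 1))) (le_max_left _ _) fun i => ?_
    refine germChain_mono' O A P hP hcompat (N i) _ ?_ (hN i)
    fin_cases i
    · exact (le_max_left _ _).trans (le_max_right _ _)
    · exact (le_max_right _ _).trans (le_max_right _ _)
  obtain ⟨t, htV, htn⟩ := ht
  obtain ⟨a, ha, b, hb, hb0, htab⟩ := germChain_frac O A P hP hfr t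
  exact ⟨t, htV, htn, a, ha, b, hb, hb0, by rw [htab, div_eq_mul_inv]⟩

variable (hDVR : IsDiscreteValuationRing ↥V)

include hk hA hfr hAO htr hcompat hca hsT hvs hsP hy hdomV hDVR in
/-- **(NDT-BP)'s EXTRA HYPOTHESIS IS A THEOREM: cofinitely no step of the germ chain principalizes at `V`.**  Zariski's
base-point budget `Zariski.eventually_not_principalizes` (res-L0-w44-strat-1) applied to the witness of
`exists_mem_not_mem_germChain`; `V` is Noetherian (a discrete valuation ring) and dominates the increasing germ chain.
This is the in-skeleton glue `Beta2Descent.noDivisorialThread_of_bp` as a tree theorem. [this work] -/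
theorem germChain_eventually_not_principalizes :
    ∃ N : ℕ, ∀ n : ℕ, N ≤ n →
      ¬ Zariski.Principalizes (fun i => locPrime (tower O A (i + 1)) (P (i + 1)) (hP (i + 1))) V n := by
  haveI := hDVR
  obtain ⟨t, htV, htn, a, ha, b, hb, hb0, htab⟩ :=
    exists_mem_not_mem_germChain O A hk hA hfr hAO htr P hP hcompat hca mₑ s hsT hvs hsP V hy hdomV
  exact Zariski.eventually_not_principalizes V inferInstance _ (germChain_mono O A P hP hcompat)
    (germChain_le O A P hP V hdomV) (germChain_inv_mem_of_valuation_eq_one O A P hP V hdomV) htV htn ha hb hb0 htab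

include hk hA hfr hAO htr hcompat hca hsT hvs hsP hy hdomV hDVR in
/-- **(NDT-abs): THE GERM CHAIN IS NOT VALUATIVELY ABSORBING along `V`** (idea-1's `not_absorbing_of_witness` with the
witness of `exists_mem_not_mem_germChain`). [this work] -/
theorem germChain_not_absorbing :
    ¬ Absorbing V (fun i => locPrime (tower O A (i + 1)) (P (i + 1)) (hP (i + 1))) := by
  haveI := hDVR
  obtain ⟨t, htV, htn, -⟩ :=
    exists_mem_not_mem_germChain O A hk hA hfr hAO htr P hP hcompat hca mₑ s hsT hvs hsP V hy hdomV
  exact not_absorbing_of_witness V inferInstance _ (fun m x hx => germChain_le O A P hP V hdomV m hx)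
    (germChain_mono' O A P hP hcompat) (germChain_inv_mem O A P hP V hdomV)
    (fun u _ => ⟨0, germChain_frac O A P hP hfr u⟩) t htV htn

include hk hA hfr hAO htr hcompat hca hsT hvs hsP hy hdomV hDVR in
/-- **(NDT-abs): `V`-IDEAL STEPS DO NOT RECUR along the germ chain** — from some stage on no step is a `V`-ideal step
(idea-1's `no_chain_of_vIdealSteps`). [this work] -/
theorem germChain_eventually_no_vIdealStep :
    ∃ m : ℕ, ∀ m' : ℕ, m ≤ m' →
      ¬ VIdealStepAt V (fun i => locPrime (tower O A (i + 1)) (P (i + 1)) (hP (i + 1))) m' := by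
  haveI := hDVR
  by_contra hcon
  push Not at hcon
  obtain ⟨t, htV, htn, -⟩ :=
    exists_mem_not_mem_germChain O A hk hA hfr hAO htr P hP hcompat hca mₑ s hsT hvs hsP V hy hdomV
  exact no_chain_of_vIdealSteps V inferInstance _ (fun m x hx => germChain_le O A P hP V hdomV m hx)
    (germChain_mono' O A P hP hcompat) (germChain_inv_mem O A P hP V hdomV)
    (fun u _ => ⟨0, germChain_frac O A P hP hfr u⟩) hcon t htV htn

include hk hA hfr hAO htr hcompat hca hsT hvs hsP hy hdomV hDVR in
/-- **(NDT-PC)'s EXTRA HYPOTHESIS IS A THEOREM: the witness has an eventually UNDIVIDED representation** (idea-2's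
`Zariski.exists_undivided_pair`): some `t ∈ V` in no germ is `a' / b'` with `a', b' ∈ D n₁` and `(a', b')` undivided in
`D m` for every `m ≥ n₁`. [this work] -/
theorem germChain_exists_undivided_pair :
    ∃ (t : K) (n₁ : ℕ) (a' b' : K), t ∈ V ∧ (∀ n : ℕ, t ∉ locPrime (tower O A (n + 1)) (P (n + 1)) (hP (n + 1))) ∧
      a' ∈ locPrime (tower O A (n₁ + 1)) (P (n₁ + 1)) (hP (n₁ + 1)) ∧
      b' ∈ locPrime (tower O A (n₁ + 1)) (P (n₁ + 1)) (hP (n₁ + 1)) ∧ b' ≠ 0 ∧ t = a' / b' ∧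
      ∀ m : ℕ, n₁ ≤ m →
        Zariski.Undivided (fun i => locPrime (tower O A (i + 1)) (P (i + 1)) (hP (i + 1))) V a' b' m := by
  haveI := hDVR
  obtain ⟨t, htV, htn, a, ha, b, hb, hb0, htab⟩ :=
    exists_mem_not_mem_germChain O A hk hA hfr hAO htr P hP hcompat hca mₑ s hsT hvs hsP V hy hdomV
  obtain ⟨n₁, a', b', -, ha', hb', hb'0, htab', hund⟩ :=
    Zariski.exists_undivided_pair V inferInstance (fun i => locPrime (tower O A (i + 1)) (P (i + 1)) (hP (i + 1)))
      (germChain_le O A P hP V hdomV) (n₀ := 0) ha hb hb0 htab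
  exact ⟨t, n₁, a', b', htV, htn, ha', hb', hb'0, htab', hund⟩

end Thread

end Summit.ResolutionOfSingularities.ResolutionOfSingularities.Theorems.NoZeno.ZariskiDescent

end
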